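import Summits.BirchSwinnertonDyer.BirchSwinnertonDyer.Theorems.ErratumRoadFiveKatoFframeLocalIndexCount
import Summits.BirchSwinnertonDyer.BirchSwinnertonDyer.Theorems.ErratumRoadFiveKatoFframeLocalLiftFixedPoints
import Summits.BirchSwinnertonDyer.Rank1Residual.X11b.KummerLocalTorsionSaturation
import Summits.BirchSwinnertonDyer.Rank1Residual.Additive.KummerVersusUnramifiedLocal
import Literature.NumberTheory.EllipticCurves.KummerSelmerStructure
import HarnessLib

/-!
# Route `ErratumRoadFive`, crux 19715 `EulerHalfNotRamNoInertSetAtFive`, line `kato_Fframe` (r5.4), stub S1Λ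
# `stub_katoLambdaLogBoundTamagawa` — HELPER R-C (I), part 2: the LOCAL INDEX `[𝓚_v ⊔ H¹_ur(K_v, E[p^k]) : 𝓚_v] = p^{v_p(c_v)}`
# for `k ≫ 0` at EVERY finite `v ∤ p` (multiplicative places included)

Seat `bsd-line-er5-p1` (LEAD g9), `--supports stmt-BirchSwinnertonDyer-19715` (helper). Theorems only: no definition, no named
fact, no instance, no notation, no `sorry`. `K : Type`. No summit statement is proved here; BSD is proved for no curve.

## What

Part 24 §2 of cell bsd-cm (`KatoDescentKummerUnramifiedLocalIndex.exists_forall_le_relIndex_kummer_sup_unramified_eq_pow_padicValNat_localTamagawaNumber`)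
computes the local factor `[𝓚_v ⊔ H¹_ur(K_v, E[p^k]) : 𝓚_v] = p^{v_p(c_v)}` (`k ≫ 0`) of the Poitou–Tate comparison (R1-d) at an
ADDITIVE `v ∤ p` (`p` odd), where `𝓚_v ⊓ H¹_ur = ⊥`.  THIS FILE proves the same VALUE at every finite `v ∤ p` and every reduction type —
binder (I) of the LEAD brief `Cruxes/EulerHalfNotRamNoInertSetAtFive/Lines/kato_Fframe_r5_RC_rethread_brief.md` — where now
`𝓚_v ⊓ H¹_ur = κ(E^{(p')})` may be non-trivial (split multiplicative `v` with `μ_p ⊂ K_v`):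

* §1 `relIndex_kummer_sup_unramified_eq_index_comap` — `[𝓚_v ⊔ H¹_ur : 𝓚_v] = [E(K_v) : κ⁻¹(H¹_ur)]`: `#H¹_ur(K_v, E[p^k]) =
  #E(K_v)[p^k] = #𝓚_v` (Milne I 2.9 / 3.3, tree `natCard_unramifiedSubgroup_eq_natCard_invariants_general`,
  `natCard_kummerLocalConditionAt_adicCompletion`), so `[𝓚 ⊔ ur : 𝓚] = [ur : 𝓚 ⊓ ur] = [𝓚 : 𝓚 ⊓ ur]`, and `𝓚 = im κ`
  (`range_localKummerMap`).
* §2 `index_comap_eq_relIndex_primary` — `[E(K_v) : κ⁻¹(H¹_ur)] = [E(K_v)[p^∞] : E(K_v)[p^∞] ⊓ κ⁻¹(H¹_ur)]` (torsion saturation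
  `E(K_v) = E(K_v)[p^∞] + p^k E(K_v)`, X11b `LocalPoints.exists_ppow_torsion_add_nsmul`, and `p^k E(K_v) = ker κ`).
* §3 `relIndex_primary_comap_eq_relIndex_nonsingularPart` — for `k ≥ c`: `[E(K_v)[p^∞] : E(K_v)[p^∞] ⊓ κ⁻¹(H¹_ur)] =
  [E(K̄)^{D_v}[p^∞] : E(K̄)^{D_v}[p^∞] ⊓ M₀]`, `M₀ = nonsingularPart`: `κ(P) ∈ H¹_ur ⟺ P` has an inertia-fixed `p^k`-th root
  (n1011 `localKummerMap_mem_unramifiedSubgroup_iff`) `⟺ P ∈ p^k · E(K̄)^{I_v}[p^∞]`, and `p^k · E(K̄)^{I_v}[p^∞] = M₀[p^∞]` for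
  `k ≥ c` (`exists_forall_pow_smul_mem`, `exists_pow_nsmul_eq_of_mem` of `…LocalLiftFixedPoints`); the rational `p^∞`-torsion is read in
  `E(K̄_v)` (torsion is algebraic, `exists_pointsMapOfEmb_eq_of_nsmul_eq_zero`; Galois descent `mem_range_toGeomPoints_iff`).
* §4 **`exists_forall_le_relIndex_kummer_sup_unramified_eq_pow_padicValNat_localTamagawaNumber`** — binder (I) VERBATIM (Part 24 §2's
  conclusion WITHOUT `hadd`/`hp2`), from §1–§3 and part 1 (`…LocalIndexCount`: `[E(K̄)^{D_v}[p^∞] : … ⊓ M₀] = p^{v_p c_v}`).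

References: [GreenbergLNM1716] §2 (pp. 72–74), §3 Lemma 3.3 (p. 87), §4 proof of Thm. 4.1 (p. 74); [MilneADT2006] Ch. I Lemma 2.9,
Lemma 3.3, Prop. 3.8; [SilvermanAEC2009] VII.§2, VII.3.1, VII.6.1–6.3, VIII.§2, X.§4; [Kato2004Asterisque] §14.8 (p. 238).
-/

noncomputable section

open scoped Classical NNReal ContRepresentation

open NumberField IsDedekindDomain Field Function WeierstrassCurve IsDedekindDomain.HeightOneSpectrum
open Literature.NumberTheory.EllipticCurves Literature.NumberTheory.EllipticCurves.GreenbergSelmer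
open Literature.NumberTheory.GaloisRepresentations Literature.NumberTheory.GaloisRepresentations.DiscreteGaloisModule
open Summit.BirchSwinnertonDyer.Rank1Residual.X11b.AcSelmer Summit.BirchSwinnertonDyer.Rank1Residual.X11b
open Summit.BirchSwinnertonDyer.BirchSwinnertonDyer.Theorems.ErratumRoadFiveKatoFframeLocalLiftFixedPoints
  Summit.BirchSwinnertonDyer.BirchSwinnertonDyer.Theorems.ErratumRoadFiveKatoFframeLocalIndexCount

set_option linter.dupNamespace false

namespace Summit.BirchSwinnertonDyer.BirchSwinnertonDyer.Theorems.ErratumRoadFiveKatoFframeLocalIndex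

variable {K : Type} [Field K] [NumberField K] (W : WeierstrassCurve K) [W.IsElliptic] (p : ℕ) [hp : Fact p.Prime]
  (v : HeightOneSpectrum (𝓞 K))

/-! ## §1 `[𝓚_v ⊔ H¹_ur : 𝓚_v] = [E(K_v) : κ⁻¹(H¹_ur)]` -/

/-- **`[𝓚_v ⊔ H¹_ur(K_v, E[p^k]) : 𝓚_v] = [E(K_v) : κ⁻¹(H¹_ur)]`** at a finite `v ∤ p`: `#H¹_ur = #E(K_v)[p^k] = #𝓚_v` (Milne I Lemma 2.9,
I Lemma 3.3: both equal `#H⁰(K_v, E[p^k])`, with `#(𝓞_v/p^k) = 1`), hence `[𝓚 ⊔ ur : 𝓚] = [ur : 𝓚 ⊓ ur] = [𝓚 : 𝓚 ⊓ ur]`, and `𝓚_v`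
is the image of the local Kummer map `κ` (`range_localKummerMap`). [cite: MilneADT2006, Ch. I, Lemma 2.9 and Lemma 3.3]
[cite: GreenbergLNM1716, §4 proof of Thm. 4.1 (p. 74)] -/
theorem relIndex_kummer_sup_unramified_eq_index_comap (hpv : ((p : ℕ) : 𝓞 K) ∉ v.asIdeal) (k : ℕ)
    (hn : ((p ^ k : ℕ) : ℤ) ≠ 0) :
    (W.kummerSelmerStructure ((p ^ k : ℕ) : ℤ) (Sum.inr v)).relIndex
        (W.kummerSelmerStructure ((p ^ k : ℕ) : ℤ) (Sum.inr v) ⊔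
          unramifiedSubgroup (GaloisRep.toLocal v (W.torsionGaloisModule ((p ^ k : ℕ) : ℤ))) 1) =
      ((unramifiedSubgroup (GaloisRep.restrictField (v.adicCompletion K) (W.torsionGaloisModule ((p ^ k : ℕ) : ℤ))) 1).comap
        (W.localKummerMap (v.adicCompletion K) hn)).index := by
  haveI : NeZero (p ^ k) := ⟨pow_ne_zero k hp.out.ne_zero⟩
  haveI : Finite (geomTorsion W ((p ^ k : ℕ) : ℤ)) := finite_geomTorsion_of_neZero W (p ^ k)
  haveI : CharZero (v.adicCompletion K) := charZero_adicCompletion v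
  set 𝓚 := W.kummerLocalConditionAt ((p ^ k : ℕ) : ℤ) (v.adicCompletion K) with h𝓚
  set U := unramifiedSubgroup (GaloisRep.restrictField (v.adicCompletion K) (W.torsionGaloisModule ((p ^ k : ℕ) : ℤ))) 1 with hU
  change 𝓚.relIndex (𝓚 ⊔ U) = (U.comap (W.localKummerMap (v.adicCompletion K) hn)).index
  rw [AddSubgroup.relIndex_sup_left]
  -- `#U = #𝓚`
  have hcardU : Nat.card U = Nat.card (nsmulAddMonoidHom (p ^ k) : (W.baseChange (v.adicCompletion K)).toAffine.Point →+ _).ker := by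
    rw [hU, Summit.BirchSwinnertonDyer.Rank1Residual.Additive.natCard_unramifiedSubgroup_eq_natCard_invariants_general,
      ← natCard_invariants_torsion_restrictField W (v.adicCompletion K) (NeZero.ne (p ^ k))]
  have hcard𝓚 : Nat.card 𝓚 = Nat.card (nsmulAddMonoidHom (p ^ k) : (W.baseChange (v.adicCompletion K)).toAffine.Point →+ _).ker := by
    rw [h𝓚, W.natCard_kummerLocalConditionAt_adicCompletion v (NeZero.ne (p ^ k)),
      LocBridge.natCard_quotient_span_pow_eq_one p v hpv k, mul_one]
  haveI : Finite 𝓚 := W.finite_kummerLocalConditionAt_adicCompletion v (NeZero.ne (p ^ k))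
  haveI : Finite U := by
    haveI := W.finite_ker_nsmul_adicCompletion v (NeZero.ne (p ^ k))
    exact Nat.finite_of_card_ne_zero (by rw [hcardU]; exact Nat.card_pos.ne')
  haveI : Finite (↥(𝓚 ⊓ U)) :=
    Finite.of_injective (AddSubgroup.inclusion (inf_le_left : 𝓚 ⊓ U ≤ 𝓚)) (AddSubgroup.inclusion_injective _)
  -- `[U : 𝓚 ⊓ U] = [𝓚 : 𝓚 ⊓ U]`
  have h1 : Nat.card (↥(𝓚 ⊓ U)) * 𝓚.relIndex U = Nat.card U := by
    have h := AddSubgroup.relIndex_mul_relIndex (⊥ : AddSubgroup _) (𝓚 ⊓ U) U bot_le inf_le_right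
    rwa [AddSubgroup.relIndex_bot_left, AddSubgroup.relIndex_bot_left, AddSubgroup.inf_relIndex_right] at h
  have h2 : Nat.card (↥(𝓚 ⊓ U)) * U.relIndex 𝓚 = Nat.card 𝓚 := by
    have h := AddSubgroup.relIndex_mul_relIndex (⊥ : AddSubgroup _) (U ⊓ 𝓚) 𝓚 bot_le inf_le_right
    rw [AddSubgroup.relIndex_bot_left, AddSubgroup.relIndex_bot_left, AddSubgroup.inf_relIndex_right, inf_comm] at h
    exact h
  have hne : Nat.card (↥(𝓚 ⊓ U)) ≠ 0 := Nat.card_pos.ne'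
  have hkey : 𝓚.relIndex U = U.relIndex 𝓚 :=
    Nat.eq_of_mul_eq_mul_left (Nat.pos_of_ne_zero hne) (by rw [h1, h2, hcardU, hcard𝓚])
  rw [hkey, h𝓚, ← W.range_localKummerMap (v.adicCompletion K) hn, ← AddSubgroup.index_comap]

/-! ## §2 Torsion saturation: `[E(K_v) : κ⁻¹(H¹_ur)] = [E(K_v)[p^∞] : E(K_v)[p^∞] ⊓ κ⁻¹(H¹_ur)]` -/

/-- **`[E(K_v) : D] = [E(K_v)[p^∞] : E(K_v)[p^∞] ⊓ D]` for `D = κ⁻¹(H¹_ur)`** (`k`-th local Kummer map at `v ∤ p`): `D ⊇ ker κ = p^k E(K_v)`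
and `E(K_v) = E(K_v)[p^∞] + p^k E(K_v)` (Silverman VII.6.3 in X11b's form `LocalPoints.exists_ppow_torsion_add_nsmul`).
[cite: SilvermanAEC2009, Prop. VII.6.3] [cite: MilneADT2006, I Lemma 3.3] -/
theorem index_comap_eq_relIndex_primary (hpv : ((p : ℕ) : 𝓞 K) ∉ v.asIdeal) (k : ℕ) (hn : ((p ^ k : ℕ) : ℤ) ≠ 0) :
    ((unramifiedSubgroup (GaloisRep.restrictField (v.adicCompletion K) (W.torsionGaloisModule ((p ^ k : ℕ) : ℤ))) 1).comap
        (W.localKummerMap (v.adicCompletion K) hn)).index =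
      (((unramifiedSubgroup (GaloisRep.restrictField (v.adicCompletion K) (W.torsionGaloisModule ((p ^ k : ℕ) : ℤ))) 1).comap
          (W.localKummerMap (v.adicCompletion K) hn)) ⊓
        AddCommGroup.primaryComponent (W.baseChange (v.adicCompletion K)).toAffine.Point p).relIndex
        (AddCommGroup.primaryComponent (W.baseChange (v.adicCompletion K)).toAffine.Point p) := by
  haveI : CharZero (v.adicCompletion K) := charZero_adicCompletion v
  set D := (unramifiedSubgroup (GaloisRep.restrictField (v.adicCompletion K) (W.torsionGaloisModule ((p ^ k : ℕ) : ℤ))) 1).comap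
    (W.localKummerMap (v.adicCompletion K) hn) with hD
  set M := AddCommGroup.primaryComponent (W.baseChange (v.adicCompletion K)).toAffine.Point p with hM
  -- `D ⊔ M = ⊤`
  have hsup : D ⊔ M = ⊤ := by
    rw [eq_top_iff]
    intro Q _
    obtain ⟨τ, R, a, hτ, rfl⟩ := LevelKummer.LocalPoints.exists_ppow_torsion_add_nsmul W p v hpv k Q
    rw [add_comm]
    refine AddSubgroup.add_mem_sup ?_ ((AddCommGroup.mem_primaryComponent).mpr ⟨a, hτ⟩)
    -- `p^k • R ∈ ker κ ⊆ D`
    rw [hD, AddSubgroup.mem_comap]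
    have h0 : W.localKummerMap (v.adicCompletion K) hn (p ^ k • R) = 0 := by
      rw [← AddMonoidHom.mem_ker, W.ker_localKummerMap (v.adicCompletion K) hn]
      exact ⟨R, by rw [zsmulAddGroupHom_apply, natCast_zsmul]⟩
    rw [h0]
    exact zero_mem _
  rw [← AddSubgroup.relIndex_top_right, ← hsup, AddSubgroup.relIndex_sup_left, AddSubgroup.inf_relIndex_right]

/-! ## §3 For `k ≥ c`: `[E(K_v)[p^∞] : E(K_v)[p^∞] ⊓ κ⁻¹(H¹_ur)] = [E(K̄)^{D_v}[p^∞] : E(K̄)^{D_v}[p^∞] ⊓ M₀]` -/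

section Transfer

variable {W} {p} {v}
  {w : Valuation (AlgebraicClosure (v.adicCompletion K)) ℝ≥0}
  (hw : ∀ x, (w x : ℝ) =
    spectralNorm (v.adicCompletion K) (AlgebraicClosure (v.adicCompletion K)) x)
  {W₀ : WeierstrassCurve w.integer}
  (hW₀ : ((W.localMinimalIntegralModel v).map (algebraMap (v.adicCompletionIntegers K)
      (v.adicCompletion K))).baseChange (AlgebraicClosure (v.adicCompletion K)) =
    W₀.baseChange (AlgebraicClosure (v.adicCompletion K)))
  {Φ : localPoints W (v.adicCompletion K) ≃+
    (((W.localMinimalIntegralModel v).map (algebraMap (v.adicCompletionIntegers K)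
      (v.adicCompletion K))).baseChange (AlgebraicClosure (v.adicCompletion K))).toAffine.Point}
  (hΦ : ∀ (σ : absoluteGaloisGroup (v.adicCompletion K)) (Q : localPoints W (v.adicCompletion K)),
    Φ (σ • Q) = Affine.Point.map ((absoluteGaloisGroup.toAlgEquiv _ σ :
        AlgebraicClosure (v.adicCompletion K) ≃ₐ[v.adicCompletion K]
          AlgebraicClosure (v.adicCompletion K)) :
        AlgebraicClosure (v.adicCompletion K) →ₐ[v.adicCompletion K]
          AlgebraicClosure (v.adicCompletion K)) (Φ Q))

include hw hΦ in
/-- **`[E(K_v)[p^∞] : E(K_v)[p^∞] ⊓ κ⁻¹(H¹_ur(K_v, E[p^k]))] = [E(K̄)^{D_v}[p^∞] : E(K̄)^{D_v}[p^∞] ⊓ M₀]` for all `k ≥ c`**, `M₀ = nonsingularPart`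
(points with non-singular reduction on the minimal model), `φ` an arithmetic Frobenius at `𝔓₀` (`E(K̄)^{D_v} = E(K̄)^{I_v} ∩ ker (φ − 1)`).
Along the injections `e : E(K_v) ↪ E(K̄_v)` and `ι_* : E(K̄) ↪ E(K̄_v)`: `e(E(K_v)[p^∞]) = ι_*(E(K̄)^{D_v}[p^∞])` (torsion is algebraic;
Galois descent), and for a rational `p`-power torsion `P` with `e P = ι_* X`: `κ(P) ∈ H¹_ur ⟺ ∃` inertia-fixed `Q`, `p^k Q = e P`
(n1011 `localKummerMap_mem_unramifiedSubgroup_iff`) `⟺ X ∈ p^k · E(K̄)^{I_v}[p^∞] ⟺ X ∈ M₀` (`k ≥ c`: `p^c · E(K̄)^{I_v}[p^∞] ⊆ M₀`,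
`M₀[p^∞]` is `p`-divisible). [cite: GreenbergLNM1716, §2 (pp. 72–74) and §4 proof of Thm. 4.1 (p. 74)]
[cite: SilvermanAEC2009, VIII.§2 (Prop. VIII.2.1 and its proof), Thm. VII.6.1, Props. VII.2.1–2.2] -/
theorem relIndex_primary_comap_eq_relIndex_nonsingularPart (hpv : ((p : ℕ) : 𝓞 K) ∉ v.asIdeal)
    {𝔐 : Ideal v.localAbsIntegers} (h𝔐 : 𝔐 ∈ v.localPrimesAbove)
    {φ : absoluteGaloisGroup K} (hφ : IsArithFrobAt (𝓞 K) φ (adicCompletionPrime K v)) (hφD : φ ∈ decomp v) :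
    ∃ c : ℕ, ∀ k, c ≤ k → ∀ (hn : ((p ^ k : ℕ) : ℤ) ≠ 0),
      (((unramifiedSubgroup (GaloisRep.restrictField (v.adicCompletion K) (W.torsionGaloisModule ((p ^ k : ℕ) : ℤ))) 1).comap
          (W.localKummerMap (v.adicCompletion K) hn)) ⊓
        AddCommGroup.primaryComponent (W.baseChange (v.adicCompletion K)).toAffine.Point p).relIndex
        (AddCommGroup.primaryComponent (W.baseChange (v.adicCompletion K)).toAffine.Point p) =
      (nonsingularPart W hW₀ Φ).relIndex
        (AddCommGroup.primaryComponent
            ↥(FixedPoints.addSubgroup ↥((adicCompletionPrime K v).inertia (absoluteGaloisGroup K)) W.geomPoints) p ⊓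
          (inertiaSubOne W.geomPoints φ hφD).ker) := by
  have hp' : p.Prime := hp.out
  haveI : CharZero (v.adicCompletion K) := charZero_adicCompletion v
  have hpu : IsUnit ((p : ℕ) : v.adicCompletionIntegers K) := by
    have h := IsDedekindDomain.HeightOneSpectrum.isUnit_algebraMap_adicCompletionIntegers K v hpv
    rwa [map_natCast] at h
  -- notation
  let Mfix := FixedPoints.addSubgroup ↥((adicCompletionPrime K v).inertia (absoluteGaloisGroup K)) W.geomPoints
  let B : AddSubgroup Mfix := AddCommGroup.primaryComponent Mfix p
  let ψ : Mfix →+ Mfix := inertiaSubOne W.geomPoints φ hφD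
  let M₀ : AddSubgroup Mfix := nonsingularPart W hW₀ Φ
  let M : AddSubgroup (W.baseChange (v.adicCompletion K)).toAffine.Point :=
    AddCommGroup.primaryComponent (W.baseChange (v.adicCompletion K)).toAffine.Point p
  let ι := closureEmb (K := K) (v.adicCompletion K)
  -- the two injections into `E(K̄_v)`
  let e : (W.baseChange (v.adicCompletion K)).toAffine.Point →+ localPoints W (v.adicCompletion K) :=
    (W.baseChangeGeomPointsEquiv (v.adicCompletion K)).toAddMonoidHom.comp (toGeomPoints (W.baseChange (v.adicCompletion K)))
  have he : ∀ P, e P = W.baseChangeGeomPointsEquiv (v.adicCompletion K) (toGeomPoints (W.baseChange (v.adicCompletion K)) P) :=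
    fun _ ↦ rfl
  have he_inj : Function.Injective e :=
    (W.baseChangeGeomPointsEquiv (v.adicCompletion K)).injective.comp (toGeomPoints_injective _)
  let g : Mfix →+ localPoints W (v.adicCompletion K) := (pointsMapOfEmb W ι).comp Mfix.subtype
  have hg : ∀ X : Mfix, g X = pointsMapOfEmb W ι (X : W.geomPoints) := fun _ ↦ rfl
  have hg_inj : Function.Injective g := (pointsMapOfEmb_injective W ι).comp Subtype.val_injective
  -- `e P` is `Γ_{K_v}`-fixed; `ι_* X` is `Γ_{K_v}`-fixed iff `X` is `D_v`-fixed; inertia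
  have he_fix : ∀ P (σ : absoluteGaloisGroup (v.adicCompletion K)), σ • e P = e P := fun P σ ↦ by
    rw [he, ← baseChangeGeomPointsEquiv_smul, smul_toGeomPoints]
  have hres : ∀ σ : absoluteGaloisGroup (v.adicCompletion K), resGalOfEmb ι σ = absGaloisRestrict K (v.adicCompletion K) σ :=
    fun _ ↦ rfl
  have hfixM : ∀ X : W.geomPoints, (∀ σ : absoluteGaloisGroup (v.adicCompletion K), σ • pointsMapOfEmb W ι X = pointsMapOfEmb W ι X) →
      (∀ x ∈ decomp v, x • X = X) := by
    intro X hX x hx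
    obtain ⟨σ, rfl⟩ := exists_eq_resGalOfEmb_of_mem_decomp v hx
    apply pointsMapOfEmb_injective W ι
    rw [pointsMapOfEmb_smul]
    exact hX σ
  have hinertia_fix : ∀ X : Mfix, ∀ τ ∈ absInertia (v.adicCompletion K), τ • g X = g X := by
    intro X τ hτ
    have hmem : absGaloisRestrict K (v.adicCompletion K) τ ∈ (adicCompletionPrime K v).inertia (absoluteGaloisGroup K) := by
      rw [inertia_adicCompletionPrime_eq_map_absInertia]
      exact Subgroup.mem_map_of_mem _ hτ
    rw [hg, ← pointsMapOfEmb_smul, hres]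
    exact congrArg _ (X.2 ⟨_, hmem⟩)
  have hmem_Mfix : ∀ Z : W.geomPoints, (∀ τ ∈ absInertia (v.adicCompletion K), τ • pointsMapOfEmb W ι Z = pointsMapOfEmb W ι Z) →
      Z ∈ Mfix := by
    intro Z hZ i
    have hi : (i : absoluteGaloisGroup K) ∈
        (absInertia (v.adicCompletion K)).map (absGaloisRestrict K (v.adicCompletion K)).toMonoidHom := by
      rw [← inertia_adicCompletionPrime_eq_map_absInertia]; exact i.2
    obtain ⟨τ, hτ, hτi⟩ := Subgroup.mem_map.mp hi
    apply pointsMapOfEmb_injective W ι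
    change pointsMapOfEmb W ι ((i : absoluteGaloisGroup K) • Z) = _
    rw [← hτi]
    change pointsMapOfEmb W ι (absGaloisRestrict K (v.adicCompletion K) τ • Z) = _
    rw [← hres, pointsMapOfEmb_smul]
    exact hZ τ hτ
  -- the threshold `c`: `p^c · E(K̄)^{I_v}[p^∞] ⊆ M₀`; divisibility of `M₀[p^∞]`
  haveI := finiteIndex_nonsingularPart hw hW₀ hΦ
  obtain ⟨c, hc⟩ := exists_forall_pow_smul_mem (p := p) W M₀
  have hdiv := exists_nsmul_eq_of_mem_nonsingularPart_of_localDivisible hw hW₀ hΦ h𝔐 hpu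
    (localDivisible_nonsingular_torsion W v hpv w hw 𝔐 h𝔐)
  refine ⟨c, fun k hk hn ↦ ?_⟩
  set U := unramifiedSubgroup (GaloisRep.restrictField (v.adicCompletion K) (W.torsionGaloisModule ((p ^ k : ℕ) : ℤ))) 1 with hU
  set D := U.comap (W.localKummerMap (v.adicCompletion K) hn) with hD
  -- (E1) `e(E(K_v)[p^∞]) = ι_*(E(K̄)^{D_v}[p^∞])`, with the correspondence `P ↦ X`
  have hE1 : ∀ P ∈ M, ∃ X : Mfix, X ∈ B ⊓ ψ.ker ∧ g X = e P := by
    intro P hP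
    obtain ⟨a, ha⟩ := (AddCommGroup.mem_primaryComponent).mp hP
    have hePa : p ^ a • e P = 0 := by rw [← map_nsmul, ha, map_zero]
    obtain ⟨X, hXa, hXe⟩ := exists_pointsMapOfEmb_eq_of_nsmul_eq_zero W ι (pow_ne_zero a hp'.ne_zero) hePa
    have hXD : ∀ x ∈ decomp v, x • X = X := hfixM X (fun σ ↦ by rw [hXe]; exact he_fix P σ)
    let Xf : Mfix := ⟨X, fun i ↦ hXD _ (inertia_adicCompletionPrime_le_decomp v i.2)⟩
    refine ⟨Xf, ⟨(AddCommGroup.mem_primaryComponent).mpr ⟨a, Subtype.ext ?_⟩,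
      (AddMonoidHom.mem_ker).mpr ((inertiaSubOne_eq_zero_iff W hφ hφD Xf).mpr hXD)⟩, hXe⟩
    rw [AddSubgroupClass.coe_nsmul, ZeroMemClass.coe_zero]; exact hXa
  have hE1' : ∀ X : Mfix, X ∈ B ⊓ ψ.ker → ∃ P ∈ M, g X = e P := by
    rintro X ⟨hXB, hXker⟩
    have hXD : ∀ x ∈ decomp v, x • (X : W.geomPoints) = X :=
      (inertiaSubOne_eq_zero_iff W hφ hφD X).mp ((AddMonoidHom.mem_ker).mp hXker)
    have hfix : ∀ σ : absoluteGaloisGroup (v.adicCompletion K), σ • g X = g X := fun σ ↦ by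
      rw [hg, ← pointsMapOfEmb_smul, hres]
      exact congrArg _ (hXD _ ⟨σ, rfl⟩)
    have hfix' : (W.baseChangeGeomPointsEquiv (v.adicCompletion K)).symm (g X) ∈
        MulAction.fixedPoints (absoluteGaloisGroup (v.adicCompletion K)) (geomPoints (W.baseChange (v.adicCompletion K))) :=
      fun σ ↦ by rw [← baseChangeGeomPointsEquiv_symm_smul, hfix σ]
    obtain ⟨P, hP⟩ := (mem_range_toGeomPoints_iff (W.baseChange (v.adicCompletion K)) _).mpr hfix'
    have heP : e P = g X := by rw [he, hP, AddEquiv.apply_symm_apply]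
    obtain ⟨a, ha⟩ := (AddCommGroup.mem_primaryComponent).mp hXB
    refine ⟨P, (AddCommGroup.mem_primaryComponent).mpr ⟨a, he_inj ?_⟩, heP.symm⟩
    rw [map_nsmul, map_zero, heP, ← map_nsmul, ha, map_zero]
  -- (E2) for `P ∈ E(K_v)[p^∞]` with `e P = g X`: `κ P ∈ H¹_ur ↔ X ∈ M₀`
  have hE2 : ∀ P ∈ M, ∀ X : Mfix, X ∈ B ⊓ ψ.ker → g X = e P → (P ∈ D ↔ X ∈ M₀) := by
    rintro P hP X ⟨hXB, -⟩ hXP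
    obtain ⟨a, ha⟩ := (AddCommGroup.mem_primaryComponent).mp hP
    rw [hD, AddSubgroup.mem_comap, hU, W.localKummerMap_mem_unramifiedSubgroup_iff hn P]
    constructor
    · rintro ⟨Q, hQn, hQI⟩
      rw [natCast_zsmul] at hQn
      -- `Q` is `p`-power torsion, hence algebraic: `Q = ι_* Z`, `Z ∈ E(K̄)^{I_v}[p^∞]`
      have hQtors : p ^ (a + k) • Q = 0 := by
        rw [pow_add, mul_smul, hQn, ← he, ← map_nsmul, ha, map_zero]
      obtain ⟨Z, hZa, hZQ⟩ := exists_pointsMapOfEmb_eq_of_nsmul_eq_zero W ι (pow_ne_zero _ hp'.ne_zero) hQtors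
      have hZM : Z ∈ Mfix := hmem_Mfix Z (fun τ hτ ↦ by rw [hZQ]; exact hQI τ hτ)
      have hZB : (⟨Z, hZM⟩ : Mfix) ∈ B := (AddCommGroup.mem_primaryComponent).mpr ⟨a + k, Subtype.ext (by
        rw [AddSubgroupClass.coe_nsmul, ZeroMemClass.coe_zero]; exact hZa)⟩
      -- `p^k • Z = X`
      have hZX : p ^ k • (⟨Z, hZM⟩ : Mfix) = X := by
        apply hg_inj
        rw [map_nsmul, hg, hZQ, hQn, ← he, ← hXP]
      rw [← hZX]
      exact hc _ hZB k hk
    · intro hXM₀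
      obtain ⟨Y, hYB, -, hYX⟩ := exists_pow_nsmul_eq_of_mem W M₀ hdiv k X hXB hXM₀
      refine ⟨g Y, ?_, hinertia_fix Y⟩
      rw [natCast_zsmul, ← map_nsmul, hYX, hXP, he]
  -- the two images agree
  have himM : M.map e = (B ⊓ ψ.ker).map g := by
    apply le_antisymm
    · rintro _ ⟨P, hP, rfl⟩
      obtain ⟨X, hX, hXP⟩ := hE1 P hP
      exact ⟨X, hX, hXP⟩
    · rintro _ ⟨X, hX, rfl⟩
      obtain ⟨P, hP, hXP⟩ := hE1' X hX
      exact ⟨P, hP, hXP.symm⟩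
  have himD : (D ⊓ M).map e = ((B ⊓ ψ.ker) ⊓ M₀).map g := by
    apply le_antisymm
    · rintro _ ⟨P, ⟨hPD, hPM⟩, rfl⟩
      obtain ⟨X, hX, hXP⟩ := hE1 P hPM
      exact ⟨X, ⟨hX, (hE2 P hPM X hX hXP).mp hPD⟩, hXP⟩
    · rintro _ ⟨X, ⟨hX, hXM₀⟩, rfl⟩
      obtain ⟨P, hP, hXP⟩ := hE1' X hX
      exact ⟨P, ⟨(hE2 P hP X hX hXP).mpr hXM₀, hP⟩, hXP.symm⟩
  -- transport the relative indices along the injections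
  calc (D ⊓ M).relIndex M
      = ((D ⊓ M).map e).relIndex (M.map e) := (AddSubgroup.relIndex_map_map_of_injective _ _ he_inj).symm
    _ = (((B ⊓ ψ.ker) ⊓ M₀).map g).relIndex ((B ⊓ ψ.ker).map g) := by rw [himM, himD]
    _ = ((B ⊓ ψ.ker) ⊓ M₀).relIndex (B ⊓ ψ.ker) := AddSubgroup.relIndex_map_map_of_injective _ _ hg_inj
    _ = M₀.relIndex (B ⊓ ψ.ker) := by rw [inf_comm, AddSubgroup.inf_relIndex_right]

end Transfer

/-! ## §4 The binder (I): `∃ k₁, ∀ k ≥ k₁, [𝓚_v ⊔ H¹_ur(K_v, E[p^k]) : 𝓚_v] = p^{v_p c_v}` -/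

/-- **`[𝓚_v ⊔ H¹_ur(K_v, E[p^k]) : 𝓚_v] = p^{v_p(c_v)}` for all large `k` at EVERY finite `v ∤ p`** (good, multiplicative or additive
reduction): binder (I) of the re-thread brief — Part 24 §2's conclusion
(`KatoDescentKummerUnramifiedLocalIndex.exists_forall_le_relIndex_kummer_sup_unramified_eq_pow_padicValNat_localTamagawaNumber`) WITHOUT the
additivity and parity hypotheses.  §1–§3 and `…LocalIndexCount.relIndex_nonsingularPart_primary_inf_ker_eq_pow`.  Greenberg: "the index
… is exactly the `p`-part `c_v^{(p)}`" (LNM 1716 p. 74); Kato §14.8's local summand. [cite: GreenbergLNM1716, §4 proof of Thm. 4.1 (p. 74)]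
[cite: MilneADT2006, Ch. I, Lemma 2.9, Lemma 3.3 and Prop. 3.8] [cite: SilvermanAEC2009, Thm. VII.6.1, Prop. VII.6.3, VIII.§2]
[cite: Kato2004Asterisque, §14.8 (p. 238)] -/
theorem exists_forall_le_relIndex_kummer_sup_unramified_eq_pow_padicValNat_localTamagawaNumber
    (hpv : ((p : ℕ) : 𝓞 K) ∉ v.asIdeal) :
    ∃ k₁ : ℕ, ∀ k, k₁ ≤ k →
      (W.kummerSelmerStructure ((p ^ k : ℕ) : ℤ) (Sum.inr v)).relIndex
          (W.kummerSelmerStructure ((p ^ k : ℕ) : ℤ) (Sum.inr v) ⊔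
            unramifiedSubgroup (GaloisRep.toLocal v (W.torsionGaloisModule ((p ^ k : ℕ) : ℤ))) 1) =
        p ^ padicValNat p ((W.baseChange (v.adicCompletion K)).localTamagawaNumber (v.adicCompletionIntegers K)) := by
  -- local data
  obtain ⟨w, hw⟩ := v.exists_spectralValuation
  obtain ⟨𝔐, h𝔐⟩ := v.localPrimesAbove_nonempty
  have hint := WeierstrassCurve.isIntegral_spectralValuation_baseChange hw (W.localMinimalIntegralModel v)
  obtain ⟨W₀, hW₀⟩ := hint.integral
  obtain ⟨C, hC⟩ := W.exists_variableChange_eq_localMinimalIntegralModel v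
  obtain ⟨Φ, hΦ⟩ := W.exists_addEquiv_localPoints_of_smul_eq v hC
  obtain ⟨φ, hφ⟩ := exists_isArithFrobAt_of_mem_primesAbove_holds (adicCompletionPrime_mem_primesAbove K v)
  have hφD : φ ∈ decomp v := (decomp_eq_decompositionSubgroup_adicCompletionPrime v).symm ▸ hφ.mem_stabilizer
  obtain ⟨c, hc⟩ := relIndex_primary_comap_eq_relIndex_nonsingularPart (W := W) (p := p) hw hW₀ hΦ hpv h𝔐 hφ hφD
  refine ⟨c, fun k hk ↦ ?_⟩
  have hn : ((p ^ k : ℕ) : ℤ) ≠ 0 := by exact_mod_cast pow_ne_zero k hp.out.ne_zero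
  rw [relIndex_kummer_sup_unramified_eq_index_comap W p v hpv k hn, index_comap_eq_relIndex_primary W p v hpv k hn, hc k hk hn,
    relIndex_nonsingularPart_primary_inf_ker_eq_pow hw hW₀ hΦ hpv h𝔐 hφ hφD]

end Summit.BirchSwinnertonDyer.BirchSwinnertonDyer.Theorems.ErratumRoadFiveKatoFframeLocalIndex

end
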